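import Literature.Computability.Cryptography.RegevLWESolveIdealised
import Literature.Computability.Cryptography.LWENoiseWidth
import Literature.Computability.Cryptography.IIDStatisticalDistance
import Literature.Probability.Distributions.GaussianWidthStatDist
import Literature.Probability.Distributions.IndepProductLawDistance
import Mathlib.Logic.Equiv.Fin.Basic
import HarnessLib

/-!
# Regev 2009, Lemma 3.7 with an average-case `Ψ̄_α`-oracle: the failure bound of the idealised secret-finding experiment for Gaussian noise

Topic `Computability/Cryptography` (family `pqc`), grouping namespace `Regev2009`; sequel of
`RegevLWESolveIdealised.lean` (the experiment "shift, query, un-shift, verify; output the first accepted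
candidate" and its abstract failure bound `n_B·η_A + (1 - σ(1 - η_R))^{|T|}`) and of
`RegevVerificationTest.lean` (Lemma 3.6). Everything here is PROVED; no named fact, no new definition
except the block indexing `levelNoise` (with body).

This file instantiates the abstract bound with the laws of Regev's reduction: the oracle batches at
"level" `k ≤ K_g` carry the discretised Gaussian noise `Ψ̄_{β_k}`, `β_k = √(β² + k·α²/K_g)` (Lemma 3.7:
the unknown width `β ≤ α` of the manufactured samples, padded by extra Gaussian noise on the grid of
`K_g + 1` magnitudes — the reduction adds the extra noise itself, so only the resulting law enters),
the verification batches carry `Ψ̄^{(qK)}_β`, and the oracle `F` solves `LWE_{q,Ψ̄_α}` from `m` samples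
with AVERAGE-case probability `≥ 2/3` (the `pqc` oracle format, `Oracle.SolvesSearchLWE … (2/3)`).

## Results

* `tvDist_lweSample_noise_le`, `tvDist_lweSamples_noise_le` — `Δ(A_{s,χ}^m, A_{s,χ'}^m) ≤ m·Δ(χ, χ')`;
  `abs_toReal_searchSuccessProb_sub_le` — **the oracle's average-case success probability moves by at
  most `m·Δ(χ, χ')` with the noise law** (Regev, proof of Lemma 3.7: "the statistical distance between
  `Ψ_α` and `Ψ_{α'}` is at most `9n^{-2c}` … `W` still succeeds");
* `exists_level_tvDist_le` — **the fitting level** (Lemma 3.7 with Claim 2.2, tree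
  `Regev2009.lemma_3_7_padding` and `LWE.tvDist_discretizedGaussian_le`): for `0 < β ≤ α`, `K_g ≥ 1`,
  some `k ≤ K_g` has `α ≤ β_k ≤ (1 + 1/K_g)α` and `Δ(Ψ̄_{β_k}, Ψ̄_α) ≤ 2/K_g`;
* `toReal_firstAccepted_ne_le_gaussian` — the abstract bound for Gaussian oracle-batch noise and an
  arbitrary verification test `Acc` with error bounds `(η_A, η_R)` under the fine law `A^{(K)}_{s,Ψ̄_β}`,
  `σ = 7/12` on the blocks whose noise is `1/(12m)`-close to `Ψ̄_α`;
* `toReal_firstAccepted_ne_le_grid` — **the bound for Regev's grid**: blocks `(k, i)`, `k ≤ K_g`,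
  `i < J` (`levelNoise`), `K_g ≥ 24m`: `Pr[output ≠ s] ≤ (K_g+1)·J·η_A + (1 - (7/12)(1 - η_R))^J`, and
  `…_le_grid_simple`: `≤ (K_g+1)·J·η_A + 2^{-J}` once `η_R ≤ 1/7`;
* `toReal_firstAccepted_ne_le_grid_cos` — the instance with Regev's cosine test of
  `RegevVerificationTest.lean` (`Acc = acceptSet q K N_V θ_α`, `4πe^{πα²} ≤ qK`):
  `η_A = e^{-N_V c/32}`, `η_R = e^{-N_V c/128}`, `c = e^{-2πα²}`. (A machine evaluates a rounded cosine;
  its test plugs into the same three theorems with its own `(η_A, η_R)`.)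

## References

* O. Regev, *On lattices, learning with errors, random linear codes, and cryptography*, J. ACM 56
  (2009), art. 34 = arXiv:2401.03703: Lemma 3.7 and its proof, Claim 2.2, Lemma 3.6, Lemma 4.1 (proof)
  [RegevLWE2009].
* C. Peikert, *Public-key cryptosystems from the worst-case shortest vector problem*, STOC 2009,
  Prop. 3.2 [Peikert2009].
-/

noncomputable section

open Finset
open scoped ENNReal Real

namespace Literature.Computability.Cryptography

namespace Regev2009

open Literature.Probability.Distributions Literature.Probability.Moments LWE

/-! ### Changing the noise law changes the oracle's average-case success by at most `m·Δ` -/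

section NoiseTV

variable {ι : Type} [Fintype ι] [DecidableEq ι] {q : ℕ} [NeZero q]

/-- `Δ(A_{s,χ}, A_{s,χ'}) ≤ Δ(χ, χ')` (same uniform `a`, data processing per `a`). [folklore] -/
theorem tvDist_lweSample_noise_le (χ χ' : PMF (ZMod q)) (s : ι → ZMod q) :
    (lweSample χ s).tvDist (lweSample χ' s) ≤ χ.tvDist χ' := by
  unfold lweSample
  exact PMF.tvDist_bind_le_of_forall_le _ _ _ fun a => PMF.tvDist_map_le_holds _ _ _

/-- `Δ(A_{s,χ}^m, A_{s,χ'}^m) ≤ m·Δ(χ, χ')` (hybrid bound `LWE.tvDist_iidPMF_le`). [folklore] -/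
theorem tvDist_lweSamples_noise_le (χ χ' : PMF (ZMod q)) (s : ι → ZMod q) (m : ℕ) :
    (lweSamples χ s m).tvDist (lweSamples χ' s m) ≤ m * χ.tvDist χ' :=
  (tvDist_iidPMF_le _ _ m).trans
    (mul_le_mul_of_nonneg_left (tvDist_lweSample_noise_le χ χ' s) (Nat.cast_nonneg m))

/-- **The average-case success probability of a solver is `m·Δ(χ, χ')`-Lipschitz in the noise law**
(Regev 2009, proof of Lemma 3.7: with `Δ(Ψ_α, Ψ_{α'}) ≤ 9n^{-2c}` per sample the oracle for `Ψ_α` still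
succeeds on `Ψ_{α'}`-samples). [cite: RegevLWE2009, Lemma 3.7 (proof)] -/
theorem abs_toReal_searchSuccessProb_sub_le (χ χ' : PMF (ZMod q)) (m : ℕ) (A : Solver ι (ZMod q) m) :
    |(searchSuccessProb χ m A).toReal - (searchSuccessProb χ' m A).toReal| ≤ m * χ.tvDist χ' := by
  have hne : ∀ (ρ : PMF (ZMod q)) (s : ι → ZMod q),
      PMF.uniformOfFintype (ι → ZMod q) s * searchSuccessProbOf ρ m A s ≠ ∞ := fun ρ s =>
    ENNReal.mul_ne_top (PMF.apply_ne_top _ _)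
      (ne_top_of_le_ne_top ENNReal.one_ne_top (searchSuccessProbOf_le_one ρ m A s))
  have hpt : ∀ (ρ : PMF (ZMod q)) (s : ι → ZMod q), (searchSuccessProbOf ρ m A s).toReal =
      (((lweSamples ρ s m).bind A).toOuterMeasure {s}).toReal := fun ρ s => by
    rw [searchSuccessProbOf, PMF.toOuterMeasure_apply_singleton]
  rw [searchSuccessProb, searchSuccessProb, ENNReal.toReal_sum (fun s _ => hne χ s),
    ENNReal.toReal_sum (fun s _ => hne χ' s), ← sum_sub_distrib]
  simp_rw [ENNReal.toReal_mul, ← mul_sub]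
  refine (abs_sum_le_sum_abs _ _).trans ?_
  calc ∑ s, |(PMF.uniformOfFintype (ι → ZMod q) s).toReal *
        ((searchSuccessProbOf χ m A s).toReal - (searchSuccessProbOf χ' m A s).toReal)|
      ≤ ∑ s, (PMF.uniformOfFintype (ι → ZMod q) s).toReal * (m * χ.tvDist χ') :=
        sum_le_sum fun s _ => by
          rw [abs_mul, abs_of_nonneg ENNReal.toReal_nonneg]
          refine mul_le_mul_of_nonneg_left ?_ ENNReal.toReal_nonneg
          rw [hpt, hpt]
          exact (PMF.abs_toReal_toOuterMeasure_bind_sub_le_tvDist _ _ A {s}).trans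
            (tvDist_lweSamples_noise_le χ χ' s m)
    _ = m * χ.tvDist χ' := by rw [← sum_mul, sum_toReal_eq_one, one_mul]

/-- One-sided form: `Pr_{χ'} ≥ Pr_χ - m·Δ(χ, χ')`. [cite: RegevLWE2009, Lemma 3.7 (proof)] -/
theorem toReal_searchSuccessProb_sub_le (χ χ' : PMF (ZMod q)) (m : ℕ) (A : Solver ι (ZMod q) m) :
    (searchSuccessProb χ m A).toReal - m * χ.tvDist χ' ≤ (searchSuccessProb χ' m A).toReal := by
  have h := (abs_sub_le_iff.1 (abs_toReal_searchSuccessProb_sub_le χ χ' m A)).1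
  linarith

end NoiseTV

/-! ### The fitting level of Regev's grid (Lemma 3.7 with Claim 2.2) -/

/-- **The fitting level.** For an unknown width `0 < β ≤ α` and the grid of extra variances
`k·α²/K_g`, `k ≤ K_g` (`K_g ≥ 1`), some level `k` gives a padded width `β_k = √(β² + kα²/K_g)` with
`α ≤ β_k ≤ (1 + 1/K_g)α`, and then `Δ(Ψ̄_{β_k}, Ψ̄_α) ≤ 2/K_g` on `ℤ_Q` for every modulus `Q`
(Regev: "`α ≤ α' ≤ (1 + n^{-2c})α` … the statistical distance between `Ψ_α` and `Ψ_{α'}` is at most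
`9n^{-2c}`"; the tree's Claim 2.2 has the constant `2` after discretisation).
[cite: RegevLWE2009, Lemma 3.7 (proof) with Claim 2.2] -/
theorem exists_level_tvDist_le (Q : ℕ) [NeZero Q] {α β : ℝ} (hβ : 0 < β) (hβα : β ≤ α) {Kg : ℕ}
    (hKg : 1 ≤ Kg) :
    ∃ k : ℕ, k ≤ Kg ∧ α ≤ Real.sqrt (β ^ 2 + k * (α ^ 2 / Kg)) ∧
      Real.sqrt (β ^ 2 + k * (α ^ 2 / Kg)) ≤ (1 + 1 / Kg) * α ∧
      (discretizedGaussian Q (Real.sqrt (β ^ 2 + k * (α ^ 2 / Kg)))).tvDist (discretizedGaussian Q α) ≤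
        2 / Kg := by
  have hα : 0 < α := hβ.trans_le hβα
  have hKpos : (0 : ℝ) < Kg := Nat.cast_pos.2 hKg
  obtain ⟨k, hk, hlow, hup, -⟩ := Regev2009.lemma_3_7_padding hβ hβα hKg
  refine ⟨k, hk, hlow, hup, ?_⟩
  have h2 : Real.sqrt (β ^ 2 + k * (α ^ 2 / Kg)) ≤ 2 * α := hup.trans (by
    have : (1 : ℝ) / Kg ≤ 1 := by rw [div_le_one hKpos]; exact_mod_cast hKg
    nlinarith)
  rw [PMF.tvDist_comm]
  refine (tvDist_discretizedGaussian_le Q hα hlow h2).trans ?_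
  have h3 : Real.sqrt (β ^ 2 + k * (α ^ 2 / Kg)) / α - 1 ≤ 1 / Kg := by
    rw [div_sub_one hα.ne', div_le_iff₀ hα]
    linarith
  calc 2 * (Real.sqrt (β ^ 2 + k * (α ^ 2 / Kg)) / α - 1) ≤ 2 * (1 / Kg) := by linarith
    _ = 2 / Kg := mul_one_div _ _

/-! ### The failure bound for Gaussian noise and an average-case `Ψ̄_α`-oracle -/

section Gaussian

variable {ι : Type} [Fintype ι] [DecidableEq ι] (q K : ℕ) [NeZero q] [NeZero K] (m NV : ℕ)

/-- From the `pqc` oracle hypothesis: `2/3 ≤ Pr` in `ℝ≥0∞` gives `2/3 ≤ Pr.toReal`. [folklore] -/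
theorem two_thirds_le_toReal {x : ℝ≥0∞} (hx1 : x ≤ 1) (h : ENNReal.ofReal (2 / 3) ≤ x) :
    (2 : ℝ) / 3 ≤ x.toReal :=
  (ENNReal.ofReal_le_iff_le_toReal (ne_top_of_le_ne_top ENNReal.one_ne_top hx1)).1 h

/-- **The failure bound with Gaussian noise.** Blocks `j < n_B` with oracle-batch noise `Ψ̄_{β_j}` and
verification noise `Ψ̄^{(qK)}_β`, a verification test `Acc` accepting each wrong candidate with
probability `≤ η_A` and rejecting `s` with probability `≤ η_R ≤ 1` (under `N_V` fine samples
`A^{(K)}_{s,Ψ̄_β}`), an oracle `F` with average-case success `≥ 2/3` on `LWE_{q,Ψ̄_α}` from `m` samples,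
and a set `T` of blocks whose noise is `1/(12m)`-close to `Ψ̄_α` (`m·Δ(Ψ̄_{β_j}, Ψ̄_α) ≤ 1/12`):
`Pr[output ≠ s] ≤ n_B η_A + (1 - (7/12)(1 - η_R))^{|T|}`.
[cite: RegevLWE2009, Lemma 3.7 (proof) with Lemmas 3.6, 4.1] -/
theorem toReal_firstAccepted_ne_le_gaussian {nB : ℕ} (βO : Fin nB → ℝ) (β : ℝ) {α : ℝ} (s : ι → ZMod q)
    (F : (Fin m → (ι → ZMod q) × ZMod q) → ι → ZMod q)
    (hF : ENNReal.ofReal (2 / 3) ≤ searchSuccessProb (discretizedGaussian q α) m fun B => PMF.pure (F B))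
    (Acc : (ι → ZMod q) → Set (Fin NV → (ι → ZMod q) × ZMod (q * K))) {ηA ηR : ℝ} (hηA : 0 ≤ ηA)
    (hA : ∀ c, c ≠ s → ((iidPMF (lweSampleK q K (discretizedGaussian (q * K) β) s) NV).toOuterMeasure
      (Acc c)).toReal ≤ ηA)
    (hR : ((iidPMF (lweSampleK q K (discretizedGaussian (q * K) β) s) NV).toOuterMeasure (Acc s)ᶜ).toReal ≤ ηR)
    (hηR : ηR ≤ 1) (T : Finset (Fin nB))
    (hT : ∀ j ∈ T, (m : ℝ) * (discretizedGaussian q (βO j)).tvDist (discretizedGaussian q α) ≤ 1 / 12) :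
    ((indepLaw nB fun j => blockLaw q K m NV (discretizedGaussian q (βO j))
        (discretizedGaussian (q * K) β) s).toOuterMeasure
        {D | firstAccepted q K m NV F Acc D ≠ some s}).toReal ≤
      nB * ηA + (1 - 7 / 12 * (1 - ηR)) ^ T.card := by
  refine toReal_firstAccepted_ne_le (fun j => discretizedGaussian q (βO j)) (discretizedGaussian (q * K) β)
    s F Acc hηA hA hR hηR T fun j hj => ?_
  have h1 := two_thirds_le_toReal (searchSuccessProb_le_one_holds _ _ _) hF
  have h2 := toReal_searchSuccessProb_sub_le (discretizedGaussian q α) (discretizedGaussian q (βO j)) m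
    fun B => PMF.pure (F B)
  rw [PMF.tvDist_comm] at h2
  linarith [hT j hj]

/-! ### Regev's grid: levels `k ≤ K_g`, `J` attempts per level -/

/-- LOCAL GLUE. The oracle-batch noise width of block `(k, i)` of Regev's grid (`k ≤ K_g` the level,
`i < J` the attempt; blocks coded by `finProdFinEquiv : Fin (K_g+1) × Fin J ≃ Fin ((K_g+1)·J)`):
`β_k = √(β² + k·α²/K_g)`, the width of the manufactured noise `Ψ_β` plus Regev's extra noise of
variance `k·α²/K_g`. [cite: RegevLWE2009, Lemma 3.7 (proof: "the set `Z` of all integer multiples of `n^{-2c}α²` between `0` and `α²`")] -/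
def levelNoise (α β : ℝ) (Kg J : ℕ) (j : Fin ((Kg + 1) * J)) : ℝ :=
  Real.sqrt (β ^ 2 + ((finProdFinEquiv.symm j).1 : ℕ) * (α ^ 2 / Kg))

/-- **Regev 2009, Lemma 3.7 with an average-case oracle — the failure bound on the grid.** With
`K_g + 1` levels of `J` independent attempts each (`K_g ≥ max(1, 24m)`, so that the fitting level's noise
is `1/(12m)`-close to `Ψ̄_α`), `0 < β ≤ α`, a verification test with error bounds `(η_A, η_R)` under
`A^{(K)}_{s,Ψ̄_β}`, and an oracle of average-case success `≥ 2/3` on `LWE_{q,Ψ̄_α}` from `m` samples: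
`Pr[output ≠ s] ≤ (K_g+1)·J·η_A + (1 - (7/12)(1 - η_R))^J`.
[cite: RegevLWE2009, Lemma 3.7 (proof) with Lemmas 3.6, 4.1 and Claim 2.2] -/
theorem toReal_firstAccepted_ne_le_grid {Kg J : ℕ} (hKg : 24 * m ≤ Kg) (hKg1 : 1 ≤ Kg) {α β : ℝ}
    (hβ : 0 < β) (hβα : β ≤ α) (s : ι → ZMod q) (F : (Fin m → (ι → ZMod q) × ZMod q) → ι → ZMod q)
    (hF : ENNReal.ofReal (2 / 3) ≤ searchSuccessProb (discretizedGaussian q α) m fun B => PMF.pure (F B))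
    (Acc : (ι → ZMod q) → Set (Fin NV → (ι → ZMod q) × ZMod (q * K))) {ηA ηR : ℝ} (hηA : 0 ≤ ηA)
    (hA : ∀ c, c ≠ s → ((iidPMF (lweSampleK q K (discretizedGaussian (q * K) β) s) NV).toOuterMeasure
      (Acc c)).toReal ≤ ηA)
    (hR : ((iidPMF (lweSampleK q K (discretizedGaussian (q * K) β) s) NV).toOuterMeasure (Acc s)ᶜ).toReal ≤ ηR)
    (hηR : ηR ≤ 1) :
    ((indepLaw ((Kg + 1) * J) fun j => blockLaw q K m NV (discretizedGaussian q (levelNoise α β Kg J j))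
        (discretizedGaussian (q * K) β) s).toOuterMeasure
        {D | firstAccepted q K m NV F Acc D ≠ some s}).toReal ≤
      ((Kg + 1) * J : ℕ) * ηA + (1 - 7 / 12 * (1 - ηR)) ^ J := by
  -- the fitting level `k*` and its `J` blocks
  obtain ⟨k, hk, -, -, htv⟩ := exists_level_tvDist_le q hβ hβα hKg1
  have hKpos : (0 : ℝ) < Kg := Nat.cast_pos.2 hKg1
  set kF : Fin (Kg + 1) := ⟨k, Nat.lt_succ_of_le hk⟩ with hkF
  have hinj : Function.Injective fun i : Fin J => finProdFinEquiv (kF, i) := fun i i' h => by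
    simpa using congrArg Prod.snd (finProdFinEquiv.injective h)
  set T : Finset (Fin ((Kg + 1) * J)) := univ.image fun i : Fin J => finProdFinEquiv (kF, i) with hTdef
  have hcard : T.card = J := by rw [hTdef, card_image_of_injective _ hinj, card_univ, Fintype.card_fin]
  have hT : ∀ j ∈ T, (m : ℝ) * (discretizedGaussian q (levelNoise α β Kg J j)).tvDist
      (discretizedGaussian q α) ≤ 1 / 12 := by
    intro j hj
    rw [hTdef, mem_image] at hj
    obtain ⟨i, -, rfl⟩ := hj
    have hlev : levelNoise α β Kg J (finProdFinEquiv (kF, i)) = Real.sqrt (β ^ 2 + k * (α ^ 2 / Kg)) := by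
      simp only [levelNoise, Equiv.symm_apply_apply]
      rfl
    rw [hlev]
    calc (m : ℝ) * (discretizedGaussian q (Real.sqrt (β ^ 2 + k * (α ^ 2 / Kg)))).tvDist
          (discretizedGaussian q α) ≤ m * (2 / Kg) :=
          mul_le_mul_of_nonneg_left htv (Nat.cast_nonneg m)
      _ ≤ 1 / 12 := by
          rw [mul_div_assoc', div_le_div_iff₀ hKpos (by norm_num : (0:ℝ) < 12)]
          have : (24 * m : ℝ) ≤ Kg := by exact_mod_cast hKg
          linarith
  have h := toReal_firstAccepted_ne_le_gaussian q K m NV (levelNoise α β Kg J) β s F hF Acc hηA hA hR hηR T hT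
  rwa [hcard] at h

/-- **Simplified form.** If moreover `η_R ≤ 1/7`, each fitting attempt is good with probability
`≥ (7/12)(6/7) = 1/2`, so `Pr[output ≠ s] ≤ (K_g+1)·J·η_A + 2^{-J}`. [cite: RegevLWE2009, Lemma 3.7 (proof)] -/
theorem toReal_firstAccepted_ne_le_grid_simple {Kg J : ℕ} (hKg : 24 * m ≤ Kg) (hKg1 : 1 ≤ Kg) {α β : ℝ}
    (hβ : 0 < β) (hβα : β ≤ α) (s : ι → ZMod q) (F : (Fin m → (ι → ZMod q) × ZMod q) → ι → ZMod q)
    (hF : ENNReal.ofReal (2 / 3) ≤ searchSuccessProb (discretizedGaussian q α) m fun B => PMF.pure (F B))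
    (Acc : (ι → ZMod q) → Set (Fin NV → (ι → ZMod q) × ZMod (q * K))) {ηA ηR : ℝ} (hηA : 0 ≤ ηA)
    (hA : ∀ c, c ≠ s → ((iidPMF (lweSampleK q K (discretizedGaussian (q * K) β) s) NV).toOuterMeasure
      (Acc c)).toReal ≤ ηA)
    (hR : ((iidPMF (lweSampleK q K (discretizedGaussian (q * K) β) s) NV).toOuterMeasure (Acc s)ᶜ).toReal ≤ ηR)
    (hηR7 : ηR ≤ 1 / 7) :
    ((indepLaw ((Kg + 1) * J) fun j => blockLaw q K m NV (discretizedGaussian q (levelNoise α β Kg J j))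
        (discretizedGaussian (q * K) β) s).toOuterMeasure
        {D | firstAccepted q K m NV F Acc D ≠ some s}).toReal ≤
      ((Kg + 1) * J : ℕ) * ηA + (1 / 2) ^ J := by
  have hR0 : 0 ≤ ((iidPMF (lweSampleK q K (discretizedGaussian (q * K) β) s) NV).toOuterMeasure (Acc s)ᶜ).toReal :=
    ENNReal.toReal_nonneg
  refine (toReal_firstAccepted_ne_le_grid q K m NV hKg hKg1 hβ hβα s F hF Acc hηA hA hR (by linarith)).trans
    (add_le_add le_rfl ?_)
  have h0 : 0 ≤ 1 - 7 / 12 * (1 - ηR) := by nlinarith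
  exact pow_le_pow_left₀ h0 (by linarith) J

/-- **The instance with Regev's cosine test** (`RegevVerificationTest.lean`): verification noise
`Ψ̄^{(qK)}_β` with `0 < β ≤ α`, `4πe^{πα²} ≤ qK`, threshold `θ_α`; with `c = e^{-2πα²}`,
`Pr[output ≠ s] ≤ (K_g+1)·J·e^{-N_V c/32} + (1 - (7/12)(1 - e^{-N_V c/128}))^J`.
[cite: RegevLWE2009, Lemma 3.7 (proof) with Lemmas 3.6, 4.1 and Claim 2.2] -/
theorem toReal_firstAccepted_ne_le_grid_cos {Kg J : ℕ} (hKg : 24 * m ≤ Kg) (hKg1 : 1 ≤ Kg) {α β : ℝ}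
    (hβ : 0 < β) (hβα : β ≤ α) (hqK : 4 * π * Real.exp (π * α ^ 2) ≤ (q * K : ℕ)) (s : ι → ZMod q)
    (F : (Fin m → (ι → ZMod q) × ZMod q) → ι → ZMod q)
    (hF : ENNReal.ofReal (2 / 3) ≤ searchSuccessProb (discretizedGaussian q α) m fun B => PMF.pure (F B)) :
    ((indepLaw ((Kg + 1) * J) fun j => blockLaw q K m NV (discretizedGaussian q (levelNoise α β Kg J j))
        (discretizedGaussian (q * K) β) s).toOuterMeasure
        {D | firstAccepted q K m NV F (acceptSet q K NV (threshold α)) D ≠ some s}).toReal ≤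
      ((Kg + 1) * J : ℕ) * Real.exp (-(NV * Real.exp (-(2 * π * α ^ 2)) / 32)) +
        (1 - 7 / 12 * (1 - Real.exp (-(NV * Real.exp (-(2 * π * α ^ 2)) / 128)))) ^ J := by
  have hβabs : |β| ≤ α := by rw [abs_of_pos hβ]; exact hβα
  refine toReal_firstAccepted_ne_le_grid q K m NV hKg hKg1 hβ hβα s F hF (acceptSet q K NV (threshold α))
    (Real.exp_pos _).le (fun c hc => toReal_accept_of_ne_le_exp q K α β hc NV)
    (toReal_reject_self_le_exp q K hβabs hqK s NV) ?_
  rw [Real.exp_le_one_iff, neg_nonpos]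
  positivity

end Gaussian

end Regev2009

end Literature.Computability.Cryptography
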